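import Literature.Analysis.Calculus.ConePoincareHomotopy
import Literature.Analysis.Calculus.HadamardLemma
import HarnessLib

/-!
# The cone (Poincaré) homotopy operator on an arbitrary normed space: smoothness and the Poincaré lemma

Topic `Analysis/Calculus`; namespace `Literature.Analysis.Calculus`.  Theorems only; no named fact,
no `sorry`.  Sequel of `ConePoincareHomotopy.lean`, which proves the cone homotopy formula
`d (h ω) + h (d ω) = ω` for `C¹` forms on a star-shaped open subset `X` of an ARBITRARY real normed
space `E` (Spivak (1965), Thm. 4-11), granted a local bound of `ω` and `Dω` on the cones over a small
ball — a bound that `ConePoincareHomotopyFiniteDim.lean` supplies by compactness when `E` is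
finite-dimensional.  Here the finite-dimensionality is removed, following Lang, *Differential and
Riemannian Manifolds* (1995), Ch. V §4, Thm. 4.1 (the Poincaré lemma on a ball — «we could have taken
our open set `U` to be star-shaped instead of an open ball», p. 136 — of a BANACH space `E`, proved
with the same operator `k`):

* `exists_nhds_prod_uIcc_subset_of_continuousOn` — the local bound: a function continuous on an
  open `Ω ⊇ {x₀} × [a, b]` is bounded on `s × [a, b] ⊆ Ω` for some neighbourhood `s` of `x₀`
  (generalized tube lemma about the compact segment `{x₀} × [a, b]`; no local compactness of `E`);
* `hasFDerivAt_intervalIntegral_of_contDiffOn`, `contDiffOn_intervalIntegral_of_contDiffOn` —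
  differentiation under the integral sign, LOCAL version on an arbitrary normed parameter space:
  if `(x, t) ↦ H x t` is `Cⁿ` on an open `Ω ⊇ V × [a, b]` (`V` open), then `x ↦ ∫ₐᵇ H x t dt` is
  `Cⁿ` on `V` (Dieudonné (1960), (8.11.2); induction on the order through
  `contDiffOn_succ_iff_fderiv_of_isOpen`, the derivative being again such an integral, of
  `∂ₓH`, with values in `E →L[ℝ] G`; the tree's `contDiff_parametric_intervalIntegral` /
  `contDiff_intervalIntegral` need `E` finite-dimensional and `H` globally smooth);
* `contDiffOn_conePrimitive` — the cone operator `h` of `ConePoincareHomotopy.lean` maps forms that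
  are `Cᵐ` on a star-shaped OPEN set `U` to forms `Cᵐ` on `U` (no cut-offs: general Banach spaces
  have no smooth bump functions, so the route of `PoincareLemmaStarConvex.lean` is not available);
* `extDeriv_conePrimitive_of_closed_of_contDiffOn`, **`exists_extDeriv_eq_of_starConvex_of_contDiffOn`**
  — the Poincaré lemma on a star-shaped open subset of an arbitrary real normed space `E`
  (coefficients in a complete `F`): a closed form of positive degree, `C^∞` on `U`, is on `U` the
  exterior derivative of a form `C^∞` on `U` (Lang (1995), V Thm. 4.1).

The value spaces of the parametric-integral lemmas are taken in the universe `Type (max u v)`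
(`E : Type u`), so that the induction may replace `G` by `E →L[ℝ] G`; this covers every space of
(multi)linear / alternating maps on `E`, in particular the spaces of forms used here.

[cite: Lang1995, Ch. V §4 Thm. 4.1 (p. 135–136)] [cite: Dieudonne1960, (8.11.2)]
[cite: Spivak1965, Thm. 4-11]

## References

* S. Lang, *Differential and Riemannian Manifolds*, GTM 160 (1995), Ch. V §4, Thm. 4.1. [Lang1995]
* J. Dieudonné, *Foundations of Modern Analysis* (1960), (8.11.2). [Dieudonne1960]
* M. Spivak, *Calculus on Manifolds* (1965), Thm. 4-11. [Spivak1965]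
-/

noncomputable section

open Set MeasureTheory intervalIntegral Filter Topology Function
open scoped Interval ContDiff

namespace Literature.Analysis.Calculus

universe u v

/-! ### Local bounds near a compact parameter segment -/

section LocalBound

variable {X : Type*} [TopologicalSpace X] {G : Type*} [SeminormedAddCommGroup G]

/-- **Local bound about a compact parameter segment.** A function `g` continuous on an open set
`Ω ⊇ {x₀} × [a, b]` is bounded on `s × [a, b]`, still inside `Ω`, for some neighbourhood `s` of `x₀`
(generalized tube lemma about the compact set `{x₀} × [a, b]`; the parameter space is arbitrary).
This is the domination used by Lang for the operator `k` on a Banach space.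
[cite: Lang1995, Ch. V §4 Thm. 4.1 (proof)] -/
theorem exists_nhds_prod_uIcc_subset_of_continuousOn {g : X × ℝ → G} {Ω : Set (X × ℝ)}
    (hΩ : IsOpen Ω) (hg : ContinuousOn g Ω) {x₀ : X} {a b : ℝ}
    (hx₀ : ({x₀} : Set X) ×ˢ uIcc a b ⊆ Ω) :
    ∃ C : ℝ, ∃ s ∈ 𝓝 x₀, s ×ˢ uIcc a b ⊆ Ω ∧ ∀ x ∈ s, ∀ t ∈ uIcc a b, ‖g (x, t)‖ ≤ C := by
  have hK : IsCompact (({x₀} : Set X) ×ˢ uIcc a b) := isCompact_singleton.prod isCompact_uIcc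
  obtain ⟨C₀, hC₀⟩ := hK.exists_bound_of_continuousOn (hg.mono hx₀)
  have hWo : IsOpen (Ω ∩ (fun p => ‖g p‖) ⁻¹' Iio (C₀ + 1)) :=
    hg.norm.isOpen_inter_preimage hΩ isOpen_Iio
  have hKW : ({x₀} : Set X) ×ˢ uIcc a b ⊆ Ω ∩ (fun p => ‖g p‖) ⁻¹' Iio (C₀ + 1) := fun p hp =>
    ⟨hx₀ hp, (hC₀ p hp).trans_lt (lt_add_one C₀)⟩
  obtain ⟨u, w, hu, -, hx₀u, htw, huw⟩ :=
    generalized_tube_lemma isCompact_singleton isCompact_uIcc hWo hKW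
  refine ⟨C₀ + 1, u, hu.mem_nhds (hx₀u rfl), fun p hp => (huw ⟨hp.1, htw hp.2⟩).1,
    fun x hx t ht => ?_⟩
  have h : (x, t) ∈ Ω ∩ (fun p => ‖g p‖) ⁻¹' Iio (C₀ + 1) := huw (mk_mem_prod hx (htw ht))
  exact le_of_lt h.2

end LocalBound

/-! ### Parametric interval integrals whose integrand is smooth on an open set -/

section Parametric

variable {E : Type u} [NormedAddCommGroup E] [NormedSpace ℝ E]
  {G : Type*} [NormedAddCommGroup G] [NormedSpace ℝ G]
  {H : E → ℝ → G} {Ω : Set (E × ℝ)} {a b : ℝ}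

omit [NormedAddCommGroup E] [NormedSpace ℝ E] in
/-- A singleton slice of a product inclusion. [cite: Dieudonne1960, (8.11.2)] -/
private theorem singleton_prod_subset {V : Set E} {S : Set ℝ} (hV : V ×ˢ S ⊆ Ω) {x : E}
    (hx : x ∈ V) : ({x} : Set E) ×ˢ S ⊆ Ω :=
  (prod_mono (singleton_subset_iff.2 hx) Subset.rfl).trans hV

omit [NormedSpace ℝ E] [NormedSpace ℝ G] in
/-- The sections `t ↦ H x t` of a function continuous on `Ω ⊇ {x} × [a, b]` are continuous on
`[a, b]`. [cite: Dieudonne1960, (8.11.2)] -/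
theorem continuousOn_section_of_continuousOn (hH : ContinuousOn (uncurry H) Ω) {x : E}
    (hx : ({x} : Set E) ×ˢ uIcc a b ⊆ Ω) : ContinuousOn (H x) (uIcc a b) :=
  hH.comp (Continuous.prodMk_right x).continuousOn fun _ ht => hx (mk_mem_prod rfl ht)

omit [NormedSpace ℝ E] [NormedSpace ℝ G] in
/-- The sections `t ↦ H x t` are a.e.-strongly measurable on `Ι a b`. [cite: Dieudonne1960, (8.11.2)] -/
theorem aestronglyMeasurable_section_of_continuousOn (hH : ContinuousOn (uncurry H) Ω) {x : E}
    (hx : ({x} : Set E) ×ˢ uIcc a b ⊆ Ω) :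
    AEStronglyMeasurable (H x) (volume.restrict (Ι a b)) :=
  ((continuousOn_section_of_continuousOn hH hx).mono uIoc_subset_uIcc).aestronglyMeasurable
    measurableSet_uIoc

omit [NormedSpace ℝ E] in
/-- **Continuity of a parametric integral, local version**: if `(x, t) ↦ H x t` is continuous on an
open `Ω ⊇ V × [a, b]`, then `x ↦ ∫ₐᵇ H x t dt` is continuous on `V` (dominated convergence with the
constant bound of `exists_nhds_prod_uIcc_subset_of_continuousOn`). [cite: Dieudonne1960, (8.11.2)] -/
theorem continuousOn_intervalIntegral_of_continuousOn_of_subset (hΩ : IsOpen Ω)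
    (hH : ContinuousOn (uncurry H) Ω) {V : Set E} (hV : V ×ˢ uIcc a b ⊆ Ω) :
    ContinuousOn (fun x => ∫ t in a..b, H x t) V := by
  intro x₀ hx₀
  have hx₀' : ({x₀} : Set E) ×ˢ uIcc a b ⊆ Ω := singleton_prod_subset hV hx₀
  obtain ⟨C, s, hs, hsΩ, hC⟩ := exists_nhds_prod_uIcc_subset_of_continuousOn hΩ hH hx₀'
  refine (intervalIntegral.continuousAt_of_dominated_interval (μ := volume)
    (bound := fun _ => C) ?_ ?_ intervalIntegrable_const ?_).continuousWithinAt
  · filter_upwards [hs] with x hx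
    exact aestronglyMeasurable_section_of_continuousOn hH (singleton_prod_subset hsΩ hx)
  · filter_upwards [hs] with x hx
    exact Eventually.of_forall fun t ht => hC x hx t (uIoc_subset_uIcc ht)
  · refine Eventually.of_forall fun t ht => ?_
    have hmem : (x₀, t) ∈ Ω := hx₀' (mk_mem_prod rfl (uIoc_subset_uIcc ht))
    have h2 : ContinuousAt (uncurry H ∘ fun x : E => (x, t)) x₀ :=
      ContinuousAt.comp (hH.continuousAt (hΩ.mem_nhds hmem)) (Continuous.prodMk_left t).continuousAt
    exact h2

/-- **One derivative under the integral sign, local version** (Dieudonné (1960), (8.11.2); Lang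
(1995), V §4, the computation of `(kω)'(x)`): if `(x, t) ↦ H x t` is `Cⁿ`, `n ≥ 1`, on an open
`Ω ⊇ {x₀} × [a, b]`, then `x ↦ ∫ₐᵇ H x t dt` has derivative `∫ₐᵇ ∂ₓH (x₀, t) dt` at `x₀` — the
domination of Mathlib's `intervalIntegral.hasFDerivAt_integral_of_dominated_of_fderiv_le` holds with
a constant bound near `x₀` by continuity of `∂ₓH` on `Ω`. [cite: Dieudonne1960, (8.11.2)] -/
theorem hasFDerivAt_intervalIntegral_of_contDiffOn (hΩ : IsOpen Ω) {n : WithTop ℕ∞}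
    (hH : ContDiffOn ℝ n (uncurry H) Ω) (hn : 1 ≤ n) {x₀ : E}
    (hx₀ : ({x₀} : Set E) ×ˢ uIcc a b ⊆ Ω) :
    HasFDerivAt (fun x => ∫ t in a..b, H x t) (∫ t in a..b, partialFDerivFst H x₀ t) x₀ := by
  have hcont : ContinuousOn (uncurry H) Ω := hH.continuousOn
  have hn0 : n ≠ 0 := ENat.one_le_iff_ne_zero_withTop.mp hn
  have hdiff : ∀ p ∈ Ω, DifferentiableAt ℝ (uncurry H) p := fun p hp =>
    (hH.differentiableOn hn0 p hp).differentiableAt (hΩ.mem_nhds hp)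
  have hcont' : ContinuousOn (uncurry (partialFDerivFst H)) Ω :=
    (hH.continuousOn_fderiv_of_isOpen hΩ hn).clm_comp continuousOn_const
  obtain ⟨C, s, hs, hsΩ, hC⟩ := exists_nhds_prod_uIcc_subset_of_continuousOn hΩ hcont' hx₀
  refine intervalIntegral.hasFDerivAt_integral_of_dominated_of_fderiv_le (μ := volume)
    (bound := fun _ => C) hs ?_ ?_ ?_ ?_ intervalIntegrable_const ?_
  · filter_upwards [hs] with x hx
    exact aestronglyMeasurable_section_of_continuousOn hcont (singleton_prod_subset hsΩ hx)
  · exact (continuousOn_section_of_continuousOn hcont hx₀).intervalIntegrable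
  · exact aestronglyMeasurable_section_of_continuousOn hcont' hx₀
  · exact Eventually.of_forall fun t ht x hx => hC x hx t (uIoc_subset_uIcc ht)
  · exact Eventually.of_forall fun t ht x hx =>
      hasFDerivAt_partialFDerivFst (hdiff _ (hsΩ (mk_mem_prod hx (uIoc_subset_uIcc ht))))

end Parametric

section ParametricSmooth

variable {E : Type u} [NormedAddCommGroup E] [NormedSpace ℝ E] {Ω : Set (E × ℝ)} {a b : ℝ}

/-- **`Cᵏ` dependence of interval integrals on parameters, local version, finite orders**
(Dieudonné (1960), (8.11.2), by induction on `k`: through `contDiffOn_succ_iff_fderiv_of_isOpen`,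
the derivative `x ↦ ∫ₐᵇ ∂ₓH (x, t) dt` is again such an integral, with values in `E →L[ℝ] G`; the
value spaces range over the universe `Type (max u v)` so that the induction hypothesis applies to
`E →L[ℝ] G`). [cite: Dieudonne1960, (8.11.2)] -/
theorem contDiffOn_intervalIntegral_nat (hΩ : IsOpen Ω) {V : Set E} (hV : IsOpen V)
    (hVΩ : V ×ˢ uIcc a b ⊆ Ω) (k : ℕ) :
    ∀ {G : Type (max u v)} [NormedAddCommGroup G] [NormedSpace ℝ G] [CompleteSpace G]
      {H : E → ℝ → G}, ContDiffOn ℝ k (uncurry H) Ω →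
        ContDiffOn ℝ k (fun x => ∫ t in a..b, H x t) V := by
  induction k with
  | zero =>
    intro G _ _ _ H hH
    rw [Nat.cast_zero, contDiffOn_zero] at hH ⊢
    exact continuousOn_intervalIntegral_of_continuousOn_of_subset hΩ hH hVΩ
  | succ k ih =>
    intro G _ _ _ H hH
    have hH' : ContDiffOn ℝ ((k : WithTop ℕ∞) + 1) (uncurry H) Ω := by exact_mod_cast hH
    have h1 : (1 : WithTop ℕ∞) ≤ (k : WithTop ℕ∞) + 1 := le_add_self
    have hderiv : ∀ x ∈ V, HasFDerivAt (fun x => ∫ t in a..b, H x t)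
        (∫ t in a..b, partialFDerivFst H x t) x := fun x hx =>
      hasFDerivAt_intervalIntegral_of_contDiffOn hΩ hH' h1
        ((prod_mono (singleton_subset_iff.2 hx) Subset.rfl).trans hVΩ)
    have hF : ContDiffOn ℝ k (uncurry (partialFDerivFst H)) Ω :=
      (hH'.fderiv_of_isOpen hΩ le_rfl).clm_comp contDiffOn_const
    rw [Nat.cast_succ, contDiffOn_succ_iff_fderiv_of_isOpen hV]
    refine ⟨fun x hx => (hderiv x hx).differentiableAt.differentiableWithinAt,
      fun h => absurd h (by exact_mod_cast WithTop.coe_ne_top), ?_⟩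
    exact (ih (H := partialFDerivFst H) hF).congr fun x hx => (hderiv x hx).fderiv

/-- **Smooth dependence of interval integrals on parameters, local version on an arbitrary real
normed space** (Dieudonné (1960), (8.11.2); the analytic heart of Lang's proof of the Poincaré lemma
on a Banach space, V §4 Thm. 4.1): if `(x, t) ↦ H x t` is `Cⁿ` (`n : ℕ∞`) on an open
`Ω ⊇ V × [a, b]` with `V` open, then `x ↦ ∫ₐᵇ H x t dt` is `Cⁿ` on `V` (values in a complete space
`G : Type (max u v)`, `E : Type u`). [cite: Dieudonne1960, (8.11.2)] -/
theorem contDiffOn_intervalIntegral_of_contDiffOn {G : Type (max u v)} [NormedAddCommGroup G]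
    [NormedSpace ℝ G] [CompleteSpace G] {H : E → ℝ → G} (hΩ : IsOpen Ω) {n : ℕ∞}
    (hH : ContDiffOn ℝ n (uncurry H) Ω) {V : Set E} (hV : IsOpen V) (hVΩ : V ×ˢ uIcc a b ⊆ Ω) :
    ContDiffOn ℝ n (fun x => ∫ t in a..b, H x t) V := by
  induction n with
  | top =>
    exact contDiffOn_infty.2 fun k =>
      contDiffOn_intervalIntegral_nat hΩ hV hVΩ k (contDiffOn_infty.1 hH k)
  | coe k => exact contDiffOn_intervalIntegral_nat hΩ hV hVΩ k hH

end ParametricSmooth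

/-! ### The cone operator on a star-shaped open subset of an arbitrary normed space -/

section Cone

variable {E : Type u} [NormedAddCommGroup E] [NormedSpace ℝ E]
  {F : Type v} [NormedAddCommGroup F] [NormedSpace ℝ F] {n : ℕ}

/-- The cone point `x₀ + t (y - x₀)` is continuous in `(y, t)` jointly. [cite: Spivak1965, Thm. 4-11] -/
theorem continuous_conePt_uncurry (x₀ : E) : Continuous fun p : E × ℝ => conePt x₀ p.1 p.2 :=
  show Continuous fun p : E × ℝ => x₀ + p.2 • (p.1 - x₀) from
    continuous_const.add (continuous_snd.smul (continuous_fst.sub continuous_const))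

/-- The cone point `x₀ + t (y - x₀)` is `C^∞` in `(y, t)` jointly. [cite: Spivak1965, Thm. 4-11] -/
theorem contDiff_conePt_uncurry (x₀ : E) {m : WithTop ℕ∞} :
    ContDiff ℝ m fun p : E × ℝ => conePt x₀ p.1 p.2 :=
  show ContDiff ℝ m fun p : E × ℝ => x₀ + p.2 • (p.1 - x₀) from
    contDiff_const.add (contDiff_snd.smul (contDiff_fst.sub contDiff_const))

/-- Over a star-shaped set the cones stay inside: `U × [0, 1]` is contained in the open set of pairs
`(y, t)` with `x₀ + t (y - x₀) ∈ U`. [cite: Lang1995, Ch. V §4 Thm. 4.1 (proof)] -/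
theorem prod_uIcc_subset_conePt_preimage {U : Set E} {x₀ : E} (hst : StarConvex ℝ x₀ U) :
    U ×ˢ uIcc (0 : ℝ) 1 ⊆ {p : E × ℝ | conePt x₀ p.1 p.2 ∈ U} := by
  rintro ⟨y, t⟩ ⟨hy, ht⟩
  rw [uIcc_of_le zero_le_one] at ht
  exact conePt_mem hst hy ht

/-- **The cone operator preserves `Cᵐ`-regularity on a star-shaped open set of an arbitrary normed
space**: if `θ` is `Cᵐ` on an open `U` star-shaped with respect to `x₀`, so is
`h θ = conePrimitive x₀ θ` (Lang (1995), V §4: differentiation under the integral sign in the Banach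
space `E`; the integrand `(y, t) ↦ tⁿ · ι_{y - x₀} θ(x₀ + t(y - x₀))` is `Cᵐ` on the open set
`{(y, t) | x₀ + t (y - x₀) ∈ U} ⊇ U × [0, 1]`). [cite: Lang1995, Ch. V §4 Thm. 4.1 (proof)] -/
theorem contDiffOn_conePrimitive [CompleteSpace F] {θ : E → E [⋀^Fin (n + 1)]→L[ℝ] F} {U : Set E}
    (hU : IsOpen U) {x₀ : E} (hst : StarConvex ℝ x₀ U) {m : ℕ∞} (hθ : ContDiffOn ℝ m θ U) :
    ContDiffOn ℝ m (conePrimitive x₀ θ) U := by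
  have hΩ : IsOpen {p : E × ℝ | conePt x₀ p.1 p.2 ∈ U} := hU.preimage (continuous_conePt_uncurry x₀)
  have hH : ContDiffOn ℝ m
      (uncurry fun (y : E) (t : ℝ) => (t ^ n) • (θ (conePt x₀ y t)).curryLeft (y - x₀))
      {p : E × ℝ | conePt x₀ p.1 p.2 ∈ U} := by
    have h1 : ContDiffOn ℝ m (fun p : E × ℝ => θ (conePt x₀ p.1 p.2))
        {p : E × ℝ | conePt x₀ p.1 p.2 ∈ U} :=
      hθ.comp (contDiff_conePt_uncurry x₀).contDiffOn fun _ hp => hp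
    have h2 : ContDiffOn ℝ m
        (fun p : E × ℝ => curryLeftCLM F n (θ (conePt x₀ p.1 p.2)) (p.1 - x₀))
        {p : E × ℝ | conePt x₀ p.1 p.2 ∈ U} :=
      ((curryLeftCLM F n).contDiff.comp_contDiffOn h1).clm_apply
        (contDiff_fst.sub contDiff_const).contDiffOn
    exact (contDiff_snd.pow n).contDiffOn.smul h2
  exact contDiffOn_intervalIntegral_of_contDiffOn hΩ hH hU (prod_uIcc_subset_conePt_preimage hst)

/-- **The cone primitive of a closed form is a primitive**, on a star-shaped open subset `U` of an
arbitrary real normed space: for `β` of class `Cᵐ`, `m ≥ 1`, on `U` with `dβ = 0` on `U`,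
`d (h β) = β` at every point of `U` — the formula `extDeriv_conePrimitive_of_closed` of
`ConePoincareHomotopy.lean`, its local bound on the cones over a ball being supplied by
`exists_nhds_prod_uIcc_subset_of_continuousOn` (continuity of `β`, `Dβ` near the compact segment
`[x₀, y]`; Lang (1995), V §4 Thm. 4.1). [cite: Lang1995, Ch. V §4 Thm. 4.1 (p. 135–136)] -/
theorem extDeriv_conePrimitive_of_closed_of_contDiffOn [CompleteSpace F]
    {β : E → E [⋀^Fin (n + 1)]→L[ℝ] F} {U : Set E} (hU : IsOpen U) {x₀ : E}
    (hst : StarConvex ℝ x₀ U) {m : WithTop ℕ∞} (hβ : ContDiffOn ℝ m β U) (hm : 1 ≤ m)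
    (hd : ∀ x ∈ U, extDeriv β x = 0) {y : E} (hy : y ∈ U) :
    extDeriv (conePrimitive x₀ β) y = β y := by
  have hc : ContinuousOn β U := hβ.continuousOn
  have hc' : ContinuousOn (fderiv ℝ β) U := hβ.continuousOn_fderiv_of_isOpen hU hm
  have hm0 : m ≠ 0 := ENat.one_le_iff_ne_zero_withTop.mp hm
  have hdiff : ∀ x ∈ U, HasFDerivAt β (fderiv ℝ β x) x := fun x hx =>
    ((hβ.differentiableOn hm0 x hx).differentiableAt (hU.mem_nhds hx)).hasFDerivAt
  have hΩ : IsOpen {p : E × ℝ | conePt x₀ p.1 p.2 ∈ U} := hU.preimage (continuous_conePt_uncurry x₀)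
  have hg₁ : ContinuousOn (fun p : E × ℝ => β (conePt x₀ p.1 p.2))
      {p : E × ℝ | conePt x₀ p.1 p.2 ∈ U} :=
    hc.comp (continuous_conePt_uncurry x₀).continuousOn fun _ hp => hp
  have hg₂ : ContinuousOn (fun p : E × ℝ => fderiv ℝ β (conePt x₀ p.1 p.2))
      {p : E × ℝ | conePt x₀ p.1 p.2 ∈ U} :=
    hc'.comp (continuous_conePt_uncurry x₀).continuousOn fun _ hp => hp
  have hy' : ({y} : Set E) ×ˢ uIcc (0 : ℝ) 1 ⊆ {p : E × ℝ | conePt x₀ p.1 p.2 ∈ U} :=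
    (prod_mono (singleton_subset_iff.2 hy) Subset.rfl).trans (prod_uIcc_subset_conePt_preimage hst)
  obtain ⟨C₁, s₁, hs₁, -, hC₁⟩ := exists_nhds_prod_uIcc_subset_of_continuousOn hΩ hg₁ hy'
  obtain ⟨C₂, s₂, hs₂, -, hC₂⟩ :=
    exists_nhds_prod_uIcc_subset_of_continuousOn (G := E →L[ℝ] E [⋀^Fin (n + 1)]→L[ℝ] F) hΩ hg₂ hy'
  obtain ⟨r, hr, hball⟩ :=
    Metric.mem_nhds_iff.1 (Filter.inter_mem (Filter.inter_mem hs₁ hs₂) (hU.mem_nhds hy))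
  refine extDeriv_conePrimitive_of_closed (C := max C₁ C₂) hst hdiff hc hc' hd hr
    (hball.trans inter_subset_right) fun y' hy' t ht => ?_
  have ht' : t ∈ uIcc (0 : ℝ) 1 := by rwa [uIcc_of_le zero_le_one]
  exact ⟨(hC₁ y' (hball hy').1.1 t ht').trans (le_max_left _ _),
    (hC₂ y' (hball hy').1.2 t ht').trans (le_max_right _ _)⟩

/-- **Poincaré lemma on a star-shaped open subset of an arbitrary real normed space** (Lang (1995),
Ch. V §4, Thm. 4.1 with the remark after its proof; Spivak (1965), Thm. 4-11 and Bott–Tu §I.4 for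
`E = ℝⁿ`): on an open `U ⊆ E` star-shaped with respect to `x₀`, every form `β` of positive degree
that is `C^∞` on `U` and closed on `U` is, on `U`, the exterior derivative of a form `C^∞` on `U` —
namely of the cone primitive `h β` (the coefficient space `F` complete).
[cite: Lang1995, Ch. V §4 Thm. 4.1 (p. 135–136)] -/
theorem exists_extDeriv_eq_of_starConvex_of_contDiffOn [CompleteSpace F]
    {β : E → E [⋀^Fin (n + 1)]→L[ℝ] F} {U : Set E} (hU : IsOpen U) {x₀ : E}
    (hst : StarConvex ℝ x₀ U) (hβ : ContDiffOn ℝ ∞ β U) (hd : ∀ x ∈ U, extDeriv β x = 0) :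
    ∃ γ : E → E [⋀^Fin n]→L[ℝ] F, ContDiffOn ℝ ∞ γ U ∧ ∀ x ∈ U, extDeriv γ x = β x :=
  ⟨conePrimitive x₀ β, contDiffOn_conePrimitive hU hst hβ, fun _ hx =>
    extDeriv_conePrimitive_of_closed_of_contDiffOn hU hst hβ (mod_cast le_top) hd hx⟩

end Cone

end Literature.Analysis.Calculus

end
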